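import Mathlib
import HarnessLib

/-!
# The finite parity–multiplicity law behind line `parity-multiplicity-commutator`
# (crux `GroundStateSimpleEven`, stmt-RiemannHypothesis-1526) — support P1

Abstract linear algebra (all three triagers asked for it to land first; it does not enter the
continuum composition, it CERTIFIES the mechanism for every finite truncation, positive or not):
let `q` be a real bilinear form on a real inner-product space `V`, `γ` a symmetric parity map, `D` a
symmetric map anticommuting with `γ`, and `η` (even), `β` (odd) vectors with the Connes–van Suijlekom
commutator identity `q(Dx, y) − q(x, Dy) = ⟨x,β⟩⟨η,y⟩ − ⟨x,η⟩⟨β,y⟩` (arXiv:2511.23257, Lemma 5.1: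
`[D, Q_N] = |β⟩⟨η| − |η⟩⟨β|` for the truncated Weil form `Q_N` and the frequency operator `D`) and
`ker D ∩ η^⊥ = 0`. If the level `λ` carries NO odd `q`-eigenvector, then any two EVEN `q`-eigenvectors at
level `λ` are linearly dependent: `dim E⁺_λ ≤ dim E⁻_λ + 1` in its `E⁻_λ = 0` instance. Proof: for even
`x ∈ E⁺_λ` with `⟨η, x⟩ = 0` the identity gives `q(Dx, ·) = λ⟨Dx, ·⟩` (the `β`-term dies because even ⊥ odd),
and `Dx` is odd, so `Dx = 0`, so `x = 0`; apply this to `x = ⟨η,x₂⟩x₁ − ⟨η,x₁⟩x₂` (or to `x₁` itself when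
both pairings vanish).
-/

namespace Summit.RiemannHypothesis.RiemannHypothesis.Theorems.GroundStateSimpleEven

-- `Summit.RiemannHypothesis.RiemannHypothesis.…` is the tree's mandated namespace for this
-- single-conjunct summit (CONVENTIONS §1), which the `dupNamespace` linter flags by design.
set_option linter.dupNamespace false

/-- **Finite parity–multiplicity law (pair form).** In a real inner-product space with a bilinear form
`q`, a symmetric involution-like parity `γ`, a symmetric `D` with `Dγ = −γD`, a vector `η` (no parity needed) and an odd
`β` (`γβ = −β`) satisfying the commutator identity
`q (D x) y − q x (D y) = ⟨x,β⟩⟨η,y⟩ − ⟨x,η⟩⟨β,y⟩` and `ker D ∩ η^⊥ = 0`: if no non-zero ODD vector is a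
`q`-eigenvector at level `lam`, then two EVEN `q`-eigenvectors `x₁, x₂` at level `lam` are linearly
dependent. This is the multiplicity shadow `m⁺(λ) ≤ m⁻(λ) + 1` of the Connes–van Suijlekom commutator
`[D, Q_N] = |β⟩⟨η| − |η⟩⟨β|` (arXiv:2511.23257, Lemma 5.1), valid for every truncation. [folklore] -/
theorem even_eigenpair_dependent_of_no_odd :
    ∀ {V : Type} [NormedAddCommGroup V] [InnerProductSpace ℝ V] (q : V →ₗ[ℝ] V →ₗ[ℝ] ℝ)
      (γ D : V →ₗ[ℝ] V) (η β : V) (lam : ℝ), (∀ x y, inner ℝ (γ x) y = inner ℝ x (γ y)) →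
      (∀ x y, inner ℝ (D x) y = inner ℝ x (D y)) → (∀ x, D (γ x) = -γ (D x)) → γ β = -β →
      (∀ x y, q (D x) y - q x (D y) = inner ℝ x β * inner ℝ η y - inner ℝ x η * inner ℝ β y) →
      (∀ x, D x = 0 → inner ℝ η x = 0 → x = 0) →
      (∀ x, (∀ y, q x y = lam * inner ℝ x y) → γ x = -x → x = 0) →
      ∀ x₁ x₂ : V, (∀ y, q x₁ y = lam * inner ℝ x₁ y) → γ x₁ = x₁ →
      (∀ y, q x₂ y = lam * inner ℝ x₂ y) → γ x₂ = x₂ →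
      ∃ c₁ c₂ : ℝ, (c₁ ≠ 0 ∨ c₂ ≠ 0) ∧ c₁ • x₁ + c₂ • x₂ = 0 := by
  intro V _ _ q γ D η β lam hγsa hDsa hDγ hβ hcomm hker hodd x₁ x₂ h₁ hγ₁ h₂ hγ₂
  -- KEY STEP: an even eigenvector orthogonal to `η` vanishes.
  have key : ∀ x : V, (∀ y, q x y = lam * inner ℝ x y) → γ x = x → inner ℝ η x = 0 → x = 0 := by
    intro x hx hγx hηx
    -- even ⊥ odd: `⟨x, β⟩ = 0`
    have hxβ : inner ℝ x β = 0 := by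
      have h1 : inner ℝ (γ x) β = inner ℝ x (γ β) := hγsa x β
      rw [hγx, hβ, inner_neg_right] at h1
      linarith
    have hxη : inner ℝ x η = 0 := by rw [real_inner_comm]; exact hηx
    -- `D x` is a `q`-eigenvector at level `lam`
    have hDx : ∀ y, q (D x) y = lam * inner ℝ (D x) y := by
      intro y
      have hc := hcomm x y
      rw [hxβ, hxη, zero_mul, zero_mul, sub_zero] at hc
      have : q (D x) y = q x (D y) := by linarith
      rw [this, hx (D y), ← hDsa x y]
    -- `D x` is odd
    have hDodd : γ (D x) = -(D x) := by
      have hodd' : D x = -γ (D x) := by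
        have := hDγ x
        rwa [hγx] at this
      calc γ (D x) = -(-(γ (D x))) := (neg_neg _).symm
        _ = -(D x) := by rw [← hodd']
    have hD0 : D x = 0 := hodd (D x) hDx hDodd
    exact hker x hD0 hηx
  by_cases hpair : inner ℝ η x₁ = 0
  · -- then `x₁` itself vanishes
    refine ⟨1, 0, Or.inl one_ne_zero, ?_⟩
    rw [key x₁ h₁ hγ₁ hpair, smul_zero, zero_smul, add_zero]
  · -- the combination `⟨η,x₂⟩ x₁ − ⟨η,x₁⟩ x₂` is an even eigenvector orthogonal to `η`
    refine ⟨inner ℝ η x₂, -inner ℝ η x₁, Or.inr (neg_ne_zero.2 hpair), ?_⟩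
    set x : V := inner ℝ η x₂ • x₁ + (-inner ℝ η x₁) • x₂ with hxdef
    have hx : ∀ y, q x y = lam * inner ℝ x y := by
      intro y
      simp only [hxdef, map_add, map_smul, LinearMap.add_apply, LinearMap.smul_apply, smul_eq_mul,
        h₁ y, h₂ y, inner_add_left, inner_smul_left, conj_trivial]
      ring
    have hγx : γ x = x := by
      simp only [hxdef, map_add, map_smul, hγ₁, hγ₂]
    have hηx : inner ℝ η x = 0 := by
      simp only [hxdef, inner_add_right, inner_smul_right]
      ring
    exact key x hx hγx hηx

end Summit.RiemannHypothesis.RiemannHypothesis.Theorems.GroundStateSimpleEven
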